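import Literature.Analysis.SpecialFunctions.DigammaLogBound
import Literature.NumberTheory.LFunctions.ZetaLogDerivRealBound
import Mathlib

/-!
# Proof of stub_smoothBound for Dictionary crux

This file proves `stub_smoothBound : ∀ t : ℝ, 100 ≤ t → |smoothPart t| ≤ 3` for the
`Dictionary` crux (stmt-RiemannHypothesis-24248), line `dictionary_v1`.

The proof bounds each of the 6 terms of `smoothPart` individually:
- |ζ'/ζ(2+it).im| < 1 (Ford's Lemma 3.1)
- |Im 1/(2+it)| ≤ t/(4+t²) ≤ 0.01
- |Im 1/(1+it)| ≤ t/(1+t²) ≤ 0.01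
- |Im ψ(1+it/2)|/2 ≤ (t/2)/(1+t²/4)/2 + π/4 ≤ 0.01 + π/4
- |2t/(t²+¼)| ≤ 2/t ≤ 0.02
- |Im ψ(¼+it/2)|/2 ≤ 0.01 + π/4

Total: 1 + 0.01 + 0.01 + (0.01 + π/4) + 0.02 + (0.01 + π/4) = 1.06 + π/2 ≈ 2.64 < 3.
-/

noncomputable section

open Complex Set Filter Topology Real
open Literature.NumberTheory.LFunctions

namespace StubSmoothBound

/-- The comparison point `2 + it` (Titchmarsh §9.6 second proof). -/
def cmpPt (t : ℝ) : ℂ := 2 + (t : ℂ) * I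

/-- The smooth part of the partial fraction decomposition of Z'/Z, differenced at `2 + it`. -/
def smoothPart (t : ℝ) : ℝ :=
  -(deriv riemannZeta (cmpPt t) / riemannZeta (cmpPt t)).im - (1 / cmpPt t).im
    - (1 / (cmpPt t - 1)).im - (Complex.digamma (cmpPt t / 2)).im / 2
    - 2 * t / (t ^ 2 + 1 / 4) + (Complex.digamma ((1 / 4 : ℂ) + ((t / 2 : ℝ) : ℂ) * I)).im / 2

/-- `normSq (2 + t*I) = 4 + t²`. -/
theorem normSq_two_plus_ti (t : ℝ) : normSq (2 + (t : ℂ) * I) = 4 + t ^ 2 := by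
  have h : (2 : ℂ) = ↑(2 : ℝ) := by norm_cast
  rw [h, normSq_add_mul_I]; ring

/-- `normSq (1 + t*I) = 1 + t²`. -/
theorem normSq_one_plus_ti (t : ℝ) : normSq (1 + (t : ℂ) * I) = 1 + t ^ 2 := by
  have h : (1 : ℂ) = ↑(1 : ℝ) := by norm_cast
  rw [h, normSq_add_mul_I]; ring

/-- `normSq (1 + (t/2)*I) = 1 + t²/4`. -/
theorem normSq_one_plus_half_ti (t : ℝ) : normSq ((1 : ℂ) + ((t / 2 : ℝ) : ℂ) * I) = 1 + t ^ 2 / 4 := by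
  have h : (1 : ℂ) = ↑(1 : ℝ) := by norm_cast
  rw [h, normSq_add_mul_I]; ring

/-- `normSq (1/4 + (t/2)*I) = 1/16 + t²/4`. -/
theorem normSq_quarter_plus_half_ti (t : ℝ) : normSq (((1 / 4 : ℝ) : ℂ) + ((t / 2 : ℝ) : ℂ) * I) = 1 / 16 + t ^ 2 / 4 := by
  rw [normSq_add_mul_I]; ring

/-- For t ≥ 100, `|Im 1/(2+it)| ≤ t/(4+t²) ≤ 0.01`. -/
theorem im_inv_two_plus_ti_bound (t : ℝ) (ht : 100 ≤ t) : |(1 / (2 + (t : ℂ) * I)).im| ≤ 0.01 := by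
  have ht0 : 0 < t := by linarith
  have h4t : 0 < 4 + t ^ 2 := by positivity
  rw [one_div, inv_im, normSq_two_plus_ti]
  simp only [add_im, ofReal_im, mul_im, ofReal_re, I_im, mul_one, I_re, mul_zero, add_zero, im_ofNat, zero_add]
  rw [show -t / (4 + t ^ 2) = -(t / (4 + t ^ 2)) by ring, abs_neg, abs_div]
  rw [abs_of_pos ht0, abs_of_pos h4t]
  have h1 : t / (4 + t ^ 2) ≤ t / t ^ 2 := div_le_div_of_nonneg_left (by nlinarith) (by positivity) (by nlinarith)
  have h2 : t / t ^ 2 = 1 / t := by field_simp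
  have h3 : 1 / t ≤ 1 / 100 := by rw [div_le_div_iff₀ ht0 (by norm_num)]; linarith
  linarith

/-- For t ≥ 100, `|Im 1/(1+it)| ≤ t/(1+t²) ≤ 0.01`. -/
theorem im_inv_one_plus_ti_bound (t : ℝ) (ht : 100 ≤ t) : |(1 / (1 + (t : ℂ) * I)).im| ≤ 0.01 := by
  have ht0 : 0 < t := by linarith
  have h1t : 0 < 1 + t ^ 2 := by positivity
  rw [one_div, inv_im, normSq_one_plus_ti]
  simp only [add_im, one_im, mul_im, ofReal_re, I_im, mul_one, ofReal_im, I_re, mul_zero, add_zero, zero_add]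
  rw [show -t / (1 + t ^ 2) = -(t / (1 + t ^ 2)) by ring, abs_neg, abs_div]
  rw [abs_of_pos ht0, abs_of_pos h1t]
  have h1 : t / (1 + t ^ 2) ≤ t / t ^ 2 := div_le_div_of_nonneg_left (by nlinarith) (by positivity) (by nlinarith)
  have h2 : t / t ^ 2 = 1 / t := by field_simp
  have h3 : 1 / t ≤ 1 / 100 := by rw [div_le_div_iff₀ ht0 (by norm_num)]; linarith
  linarith

/-- For t ≥ 100, `|2t/(t²+¼)| ≤ 2/t ≤ 0.02`. -/
theorem term5_bound (t : ℝ) (ht : 100 ≤ t) : |2 * t / (t ^ 2 + 1 / 4)| ≤ 0.02 := by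
  have ht0 : 0 < t := by linarith
  rw [abs_div, abs_of_pos (by linarith : 0 < 2 * t), abs_of_pos (by positivity : 0 < t ^ 2 + 1 / 4)]
  have h1 : 2 * t / (t ^ 2 + 1 / 4) ≤ 2 * t / t ^ 2 := div_le_div_of_nonneg_left (by nlinarith) (by positivity) (by nlinarith)
  have h2 : 2 * t / t ^ 2 = 2 / t := by field_simp
  have h3 : 2 / t ≤ 2 / 100 := by rw [div_le_div_iff₀ ht0 (by norm_num)]; linarith
  linarith

/-- `|ζ'/ζ(2+it).im| < 1` (Ford's Lemma 3.1: `|ζ'/ζ(s)| < 1/(σ-1)` for σ > 1). -/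
theorem logDeriv_zeta_bound (t : ℝ) :
    |(deriv riemannZeta (2 + (t : ℂ) * I) / riemannZeta (2 + (t : ℂ) * I)).im| < 1 := by
  have hre : (2 + (t : ℂ) * I).re = 2 := by simp
  have h1 : 1 < (2 + (t : ℂ) * I).re := by rw [hre]; norm_num
  have h := norm_deriv_riemannZeta_div_lt h1
  have hlt : 1 / ((2 + (t : ℂ) * I).re - 1) = 1 := by rw [hre]; norm_num
  rw [hlt] at h
  calc |(deriv riemannZeta (2 + (t : ℂ) * I) / riemannZeta (2 + (t : ℂ) * I)).im|
      ≤ ‖deriv riemannZeta (2 + (t : ℂ) * I) / riemannZeta (2 + (t : ℂ) * I)‖ := abs_im_le_norm _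
    _ < 1 := h

/-- `‖z‖² = normSq z` for complex z. -/
theorem norm_sq_eq_normSq (z : ℂ) : ‖z‖ ^ 2 = normSq z := (normSq_eq_norm_sq z).symm

/-- For t ≥ 100, `|Im ψ(1+it/2)|/2 ≤ 0.01 + π/4`. -/
theorem digamma_bound_1 (t : ℝ) (ht : 100 ≤ t) :
    |(digamma ((1 : ℂ) + ((t / 2 : ℝ) : ℂ) * I)).im| / 2 ≤ 0.01 + Real.pi / 4 := by
  have ht0 : 0 < t := by linarith
  have hre_pos : 0 < ((1 : ℂ) + ((t / 2 : ℝ) : ℂ) * I).re := by simp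
  have him_ne : ((1 : ℂ) + ((t / 2 : ℝ) : ℂ) * I).im ≠ 0 := by simp; linarith
  have h := Literature.Analysis.SpecialFunctions.Complex.abs_im_digamma_le hre_pos him_ne
  simp only [ofReal_re, I_re, mul_zero, ofReal_im, I_im, mul_one,
    add_zero, add_im, one_im, mul_im] at h
  have hnorm : ‖(1 : ℂ) + ((t / 2 : ℝ) : ℂ) * I‖ ^ 2 = 1 + t ^ 2 / 4 := by
    rw [norm_sq_eq_normSq, normSq_one_plus_half_ti]
  rw [hnorm] at h
  simp only [zero_add] at h
  have habs : |t / 2| = t / 2 := abs_of_pos (by linarith)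
  rw [habs] at h
  have h_term : t / 2 / (1 + t ^ 2 / 4) ≤ 2 / t := by
    have eq1 : t / 2 / (1 + t ^ 2 / 4) = 2 * t / (4 + t ^ 2) := by field_simp; ring
    have h2 : 2 * t / (4 + t ^ 2) ≤ 2 * t / t ^ 2 := div_le_div_of_nonneg_left (by nlinarith) (by positivity) (by nlinarith)
    have h3 : 2 * t / t ^ 2 = 2 / t := by field_simp
    linarith
  have h_2t : 2 / t ≤ 2 / 100 := by rw [div_le_div_iff₀ ht0 (by norm_num)]; linarith
  have h_final : |(digamma ((1 : ℂ) + ((t / 2 : ℝ) : ℂ) * I)).im| ≤ 0.02 + Real.pi / 2 := by linarith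
  calc |(digamma ((1 : ℂ) + ((t / 2 : ℝ) : ℂ) * I)).im| / 2
      ≤ (0.02 + Real.pi / 2) / 2 := div_le_div_of_nonneg_right h_final (by norm_num)
    _ = 0.01 + Real.pi / 4 := by ring

/-- For t ≥ 100, `|Im ψ(¼+it/2)|/2 ≤ 0.01 + π/4`. -/
theorem digamma_bound_quarter (t : ℝ) (ht : 100 ≤ t) :
    |(digamma (((1 / 4 : ℝ) : ℂ) + ((t / 2 : ℝ) : ℂ) * I)).im| / 2 ≤ 0.01 + Real.pi / 4 := by
  have ht0 : 0 < t := by linarith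
  have hre_pos : 0 < (((1 / 4 : ℝ) : ℂ) + ((t / 2 : ℝ) : ℂ) * I).re := by simp
  have him_ne : (((1 / 4 : ℝ) : ℂ) + ((t / 2 : ℝ) : ℂ) * I).im ≠ 0 := by simp; linarith
  have h := Literature.Analysis.SpecialFunctions.Complex.abs_im_digamma_le hre_pos him_ne
  simp only [ofReal_re, I_re, mul_zero, ofReal_im, I_im, mul_one,
    add_im, mul_im, add_zero] at h
  have hnorm : ‖((1 / 4 : ℝ) : ℂ) + ((t / 2 : ℝ) : ℂ) * I‖ ^ 2 = 1 / 16 + t ^ 2 / 4 := by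
    rw [norm_sq_eq_normSq, normSq_quarter_plus_half_ti]
  rw [hnorm] at h
  simp only [zero_add] at h
  have habs : |t / 2| = t / 2 := abs_of_pos (by linarith)
  rw [habs] at h
  have h_term : t / 2 / (1 / 16 + t ^ 2 / 4) ≤ 2 / t := by
    have eq1 : t / 2 / (1 / 16 + t ^ 2 / 4) = 8 * t / (1 + 4 * t ^ 2) := by field_simp; ring
    have h2 : 8 * t / (1 + 4 * t ^ 2) ≤ 8 * t / (4 * t ^ 2) := div_le_div_of_nonneg_left (by nlinarith) (by positivity) (by nlinarith)
    have h3 : 8 * t / (4 * t ^ 2) = 2 / t := by field_simp; ring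
    linarith
  have h_2t : 2 / t ≤ 2 / 100 := by rw [div_le_div_iff₀ ht0 (by norm_num)]; linarith
  have h_final : |(digamma (((1 / 4 : ℝ) : ℂ) + ((t / 2 : ℝ) : ℂ) * I)).im| ≤ 0.02 + Real.pi / 2 := by linarith
  calc |(digamma (((1 / 4 : ℝ) : ℂ) + ((t / 2 : ℝ) : ℂ) * I)).im| / 2
      ≤ (0.02 + Real.pi / 2) / 2 := div_le_div_of_nonneg_right h_final (by norm_num)
    _ = 0.01 + Real.pi / 4 := by ring

/-- **stub_smoothBound**: For t ≥ 100, `|smoothPart t| ≤ 3`.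
Bounds each of the 6 terms individually, then combines via `|x| ≤ b ↔ -b ≤ x ∧ x ≤ b`. -/
theorem stub_smoothBound : ∀ t : ℝ, 100 ≤ t → |smoothPart t| ≤ 3 := by
  intro t ht
  have ht0 : 0 < t := by linarith
  have hπ : Real.pi < 3.15 := Real.pi_lt_d2
  have hcmp : cmpPt t = 2 + (t : ℂ) * I := rfl
  have hcmp1 : cmpPt t - 1 = 1 + (t : ℂ) * I := by simp [cmpPt]; ring
  have hcmp2 : cmpPt t / 2 = (1 : ℂ) + ((t / 2 : ℝ) : ℂ) * I := by simp [cmpPt]; ring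
  have hdig_eq : ((1 / 4 : ℂ) + ((t / 2 : ℝ) : ℂ) * I) = ((1 / 4 : ℝ) : ℂ) + ((t / 2 : ℝ) : ℂ) * I := by push_cast; ring
  have hT1 : |(deriv riemannZeta (cmpPt t) / riemannZeta (cmpPt t)).im| < 1 := by rw [hcmp]; exact logDeriv_zeta_bound t
  have hT2 : |(1 / cmpPt t).im| ≤ 0.01 := by rw [hcmp]; exact im_inv_two_plus_ti_bound t ht
  have hT3 : |(1 / (cmpPt t - 1)).im| ≤ 0.01 := by rw [hcmp1]; exact im_inv_one_plus_ti_bound t ht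
  have hT4 : |(digamma (cmpPt t / 2)).im| / 2 ≤ 0.01 + Real.pi / 4 := by rw [hcmp2]; exact digamma_bound_1 t ht
  have hT5 : |2 * t / (t ^ 2 + 1 / 4)| ≤ 0.02 := term5_bound t ht
  have hT6 : |(digamma ((1 / 4 : ℂ) + ((t / 2 : ℝ) : ℂ) * I)).im| / 2 ≤ 0.01 + Real.pi / 4 := by
    rw [hdig_eq]; exact digamma_bound_quarter t ht
  unfold smoothPart
  have hπ4 : Real.pi / 4 < 0.79 := by linarith
  have hT4' : |(digamma (cmpPt t / 2)).im / 2| ≤ 0.01 + Real.pi / 4 := by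
    rw [abs_div, abs_of_pos (by norm_num : (0 : ℝ) < 2)]; exact hT4
  have hT6' : |(digamma ((1 / 4 : ℂ) + ((t / 2 : ℝ) : ℂ) * I)).im / 2| ≤ 0.01 + Real.pi / 4 := by
    rw [abs_div, abs_of_pos (by norm_num : (0 : ℝ) < 2)]; exact hT6
  have h_sum : |(deriv riemannZeta (cmpPt t) / riemannZeta (cmpPt t)).im| + |(1 / cmpPt t).im| +
      |(1 / (cmpPt t - 1)).im| + |(digamma (cmpPt t / 2)).im / 2| +
      |2 * t / (t ^ 2 + 1 / 4)| + |(digamma ((1 / 4 : ℂ) + ((t / 2 : ℝ) : ℂ) * I)).im / 2| < 3 := by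
    calc |(deriv riemannZeta (cmpPt t) / riemannZeta (cmpPt t)).im| + |(1 / cmpPt t).im| +
        |(1 / (cmpPt t - 1)).im| + |(digamma (cmpPt t / 2)).im / 2| +
        |2 * t / (t ^ 2 + 1 / 4)| + |(digamma ((1 / 4 : ℂ) + ((t / 2 : ℝ) : ℂ) * I)).im / 2|
      < 1 + 0.01 + 0.01 + (0.01 + Real.pi / 4) + 0.02 + (0.01 + Real.pi / 4) := by linarith
    _ = 1.06 + Real.pi / 2 := by ring
    _ < 1.06 + 1.575 := by linarith
    _ < 3 := by norm_num
  rw [abs_le]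
  have hT1_bounds := abs_lt.mp hT1
  have hT2_bounds := abs_le.mp hT2
  have hT3_bounds := abs_le.mp hT3
  have hT4'_bounds := abs_le.mp hT4'
  have hT5_bounds := abs_le.mp hT5
  have hT6'_bounds := abs_le.mp hT6'
  constructor
  · have h1 : -(deriv riemannZeta (cmpPt t) / riemannZeta (cmpPt t)).im ≥ -1 := by linarith [hT1_bounds.1, hT1_bounds.2]
    have h2 : -(1 / cmpPt t).im ≥ -0.01 := by linarith [hT2_bounds.1, hT2_bounds.2]
    have h3 : -(1 / (cmpPt t - 1)).im ≥ -0.01 := by linarith [hT3_bounds.1, hT3_bounds.2]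
    have h4 : -(digamma (cmpPt t / 2)).im / 2 ≥ -(0.01 + Real.pi / 4) := by
      have heq : -(digamma (cmpPt t / 2)).im / 2 = -((digamma (cmpPt t / 2)).im / 2) := by ring
      rw [heq]; linarith [hT4'_bounds.1, hT4'_bounds.2]
    have h5 : -(2 * t / (t ^ 2 + 1 / 4)) ≥ -0.02 := by linarith [hT5_bounds.1, hT5_bounds.2]
    have h6 : (digamma ((1 / 4 : ℂ) + ((t / 2 : ℝ) : ℂ) * I)).im / 2 ≥ -(0.01 + Real.pi / 4) := by linarith [hT6'_bounds.1, hT6'_bounds.2]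
    linarith
  · have h1 : -(deriv riemannZeta (cmpPt t) / riemannZeta (cmpPt t)).im ≤ 1 := by linarith [hT1_bounds.1, hT1_bounds.2]
    have h2 : -(1 / cmpPt t).im ≤ 0.01 := by linarith [hT2_bounds.1, hT2_bounds.2]
    have h3 : -(1 / (cmpPt t - 1)).im ≤ 0.01 := by linarith [hT3_bounds.1, hT3_bounds.2]
    have h4 : -(digamma (cmpPt t / 2)).im / 2 ≤ 0.01 + Real.pi / 4 := by
      have heq : -(digamma (cmpPt t / 2)).im / 2 = -((digamma (cmpPt t / 2)).im / 2) := by ring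
      rw [heq]; linarith [hT4'_bounds.1, hT4'_bounds.2]
    have h5 : -(2 * t / (t ^ 2 + 1 / 4)) ≤ 0.02 := by linarith [hT5_bounds.1, hT5_bounds.2]
    have h6 : (digamma ((1 / 4 : ℂ) + ((t / 2 : ℝ) : ℂ) * I)).im / 2 ≤ 0.01 + Real.pi / 4 := by linarith [hT6'_bounds.1, hT6'_bounds.2]
    linarith

end StubSmoothBound
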